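import Summits.BirchSwinnertonDyer.BirchSwinnertonDyer.Theorems.ManinLocalTwoThreeThreeTorsionAscentIffCongruence
import Literature.NumberTheory.EllipticCurves.IsogenyBaseChange
import Literature.NumberTheory.EllipticCurves.DivisionPolynomialTorsion
import HarnessLib

/-!
# The rational `3`-torsion point of `W` attached to `T ∈ E♮(ℚ)`, as a `Γ_ℚ`-fixed geometric point of order `3`

Summit `BirchSwinnertonDyer`, route `ManinLocalTwoThree` (cell bsd-f2-manin), crux C3 `ManinPrimeToThreeAtNine`
(stmt-BirchSwinnertonDyer-22968), line `kato_shift_three`; the point-level input of the lead's `Isogeny`-object construction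
(VÉLU₃♯) BY NAME (`Theorems/ManinLocalTwoThreeThreeTorsionIsogenyAscent.lean`).  For `T = (X₁, Y₁)` of order `3` on the intrinsic
short model `E♮ = E_{W,1}` (`IsShortThreeTorsion W 1 X₁ Y₁`):
* `equation_of_isShortThreeTorsion_model` — `(X₁ − b₂/12, Y₁ − (a₁x + a₃)/2)` lies on `W`;
* `exists_geomPoint_of_isShortThreeTorsion` — as a point `P₀ ∈ W(ℚ̄)` it is fixed by every `σ ∈ Γ_ℚ` and has order exactly `3`
  (`3P₀ = 0 ⟺ Ψ₃(x) = 0`, the tree's `three_smul_some_eq_zero_iff`, and `Ψ₃^W(X₁ − b₂/12) = Ψ₃^{E♮}(X₁) = 0`).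

HONEST FRAMING: elementary; nothing about C3, Manin's conjecture or BSD is proved.  No definitions, no named facts, no sorry.
References: [SilvermanAEC2009] III.1, III.2.3, Exercise 3.7.
-/

set_option linter.dupNamespace false
set_option autoImplicit false

noncomputable section

open scoped Classical

open WeierstrassCurve IsDedekindDomain NumberField Rat.HeightOneSpectrum Polynomial
  Literature.NumberTheory.DiophantineGeometry Literature.NumberTheory.EllipticCurves
  Literature.NumberTheory.EllipticCurves.ModularForms
  Summit.BirchSwinnertonDyer.Rank1Residual.ManinAdditive
  Summit.BirchSwinnertonDyer.Rank1Residual.ManinAdditive.CuspidalKummer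
  Summit.BirchSwinnertonDyer.Rank1Residual.ManinAdditive.CuspidalKummerThree

namespace Summit.BirchSwinnertonDyer.BirchSwinnertonDyer.Theorems.ManinLocalTwoThree

/-! ### §1. The rational `3`-torsion point of `W` attached to `T ∈ E♮(ℚ)` -/

/-- `T = (X₁, Y₁)` on `E♮` gives the rational point `(X₁ − b₂/12, Y₁ − (a₁x + a₃)/2)` of `W`. [folklore] -/
theorem equation_of_isShortThreeTorsion_model (W : WeierstrassCurve ℚ) {X₁ Y₁ : ℚ}
    (hT : IsShortThreeTorsion W 1 X₁ Y₁) :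
    W.toAffine.Equation (X₁ - W.b₂ / 12) (Y₁ - (W.a₁ * (X₁ - W.b₂ / 12) + W.a₃) / 2) := by
  have heq := equation_of_isShortThreeTorsion hT
  have ha4 : (shortModel W 1).a₄ = -(W.c₄ / 48) := by simp [shortModel]
  have ha6 : (shortModel W 1).a₆ = -(W.c₆ / 864) := by simp [shortModel]
  rw [ha4, ha6] at heq
  rw [WeierstrassCurve.Affine.equation_iff]
  simp only [WeierstrassCurve.c₄, WeierstrassCurve.c₆, WeierstrassCurve.b₂, WeierstrassCurve.b₄, WeierstrassCurve.b₆] at heq ⊢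
  linear_combination heq

/-- The rational `3`-torsion point as a `Γ_ℚ`-FIXED geometric point of `W` of order `3`: the affine point `P₀ ∈ W(ℚ̄)` with the
rational coordinates `(X₁ − b₂/12, Y₁ − (a₁x + a₃)/2)` is nonsingular, fixed by every `σ ∈ Γ_ℚ`, and has order `3`
(`Ψ₃(X₁ − b₂/12) = 0`, Silverman Exercise 3.7). [cite: SilvermanAEC2009, III.2.3 and Exercise 3.7] -/
theorem exists_geomPoint_of_isShortThreeTorsion (W : WeierstrassCurve ℚ) [W.IsElliptic] {X₁ Y₁ : ℚ}
    (hT : IsShortThreeTorsion W 1 X₁ Y₁) :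
    ∃ (h : (W.baseChange (AlgebraicClosure ℚ)).toAffine.Nonsingular
        (algebraMap ℚ (AlgebraicClosure ℚ) (X₁ - W.b₂ / 12))
        (algebraMap ℚ (AlgebraicClosure ℚ) (Y₁ - (W.a₁ * (X₁ - W.b₂ / 12) + W.a₃) / 2)))
      (P₀ : W.geomPoints), P₀ = Affine.Point.some _ _ h ∧
      (∀ σ : Field.absoluteGaloisGroup ℚ, σ • P₀ = P₀) ∧ addOrderOf P₀ = 3 := by
  set ι := algebraMap ℚ (AlgebraicClosure ℚ) with hι
  set x : ℚ := X₁ - W.b₂ / 12 with hx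
  set y : ℚ := Y₁ - (W.a₁ * (X₁ - W.b₂ / 12) + W.a₃) / 2 with hy
  have heqQ : W.toAffine.Equation x y := equation_of_isShortThreeTorsion_model W hT
  have heq : (W.baseChange (AlgebraicClosure ℚ)).toAffine.Equation (ι x) (ι y) :=
    WeierstrassCurve.Affine.Equation.map (algebraMap ℚ (AlgebraicClosure ℚ)) heqQ
  have hns : (W.baseChange (AlgebraicClosure ℚ)).toAffine.Nonsingular (ι x) (ι y) :=
    (WeierstrassCurve.Affine.equation_iff_nonsingular).mp heq
  set P₀ : W.geomPoints := Affine.Point.some _ _ hns with hP₀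
  refine ⟨hns, P₀, hP₀, ?_, ?_⟩
  · intro σ
    obtain ⟨h', e⟩ := WeierstrassCurve.geomPoints.smul_some (W := W) σ hns
    have e1 : Field.absoluteGaloisGroup.toAlgEquiv ℚ σ (ι x) = ι x :=
      (Field.absoluteGaloisGroup.toAlgEquiv ℚ σ).commutes x
    have e2 : Field.absoluteGaloisGroup.toAlgEquiv ℚ σ (ι y) = ι y :=
      (Field.absoluteGaloisGroup.toAlgEquiv ℚ σ).commutes y
    rw [hP₀, e]
    simp only [e1, e2]
  · -- order `3`: `3 • P₀ = 0 ⟺ ψ₃(P₀) = 0`, `ψ₃ = Ψ₃(x)`, `Ψ₃^W(X₁ − b₂/12) = Ψ₃^{E♮}(X₁) = 0`; `P₀ ≠ 0`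
    have hY0 := y_ne_zero_of_isShortThreeTorsion hT
    have hyneg : ι y ≠ (W.baseChange (AlgebraicClosure ℚ)).toAffine.negY (ι x) (ι y) := by
      intro h
      rw [WeierstrassCurve.Affine.negY] at h
      have ha₁ : (W.baseChange (AlgebraicClosure ℚ)).a₁ = ι W.a₁ := rfl
      have ha₃ : (W.baseChange (AlgebraicClosure ℚ)).a₃ = ι W.a₃ := rfl
      rw [ha₁, ha₃, ← map_mul, ← map_neg, ← map_sub, ← map_sub] at h
      have h2 := (algebraMap ℚ (AlgebraicClosure ℚ)).injective h
      apply hY0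
      rw [hy, hx] at h2
      linear_combination h2 / 2
    have hsm : shortModel W 1 = (⟨0, 0, 0, -W.c₄ / 48, -W.c₆ / 864⟩ : WeierstrassCurve ℚ) := by
      ext <;> simp [shortModel] <;> ring
    have hq : W.Ψ₃.eval x = 0 := by
      rw [hx, Ψ₃_eval_sub_b₂_div_twelve, ← hsm]
      exact hT.2.eq_zero
    have h3 : (3 : ℤ) • (Affine.Point.some _ _ hns : (W.baseChange (AlgebraicClosure ℚ)).toAffine.Point) = 0 := by
      rw [WeierstrassCurve.three_smul_some_eq_zero_iff hns hyneg, WeierstrassCurve.ψ_three, Polynomial.evalEval_C]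
      have hmap : (W.baseChange (AlgebraicClosure ℚ)).Ψ₃ = W.Ψ₃.map ι := WeierstrassCurve.map_Ψ₃ W ι
      rw [hmap, Polynomial.eval_map, Polynomial.eval₂_hom, hq, map_zero]
    haveI : Fact (Nat.Prime 3) := ⟨Nat.prime_three⟩
    refine addOrderOf_eq_prime ?_ ?_
    · have : ((3 : ℕ) : ℤ) • P₀ = 0 := h3
      rwa [natCast_zsmul] at this
    · exact Affine.Point.some_ne_zero hns

end Summit.BirchSwinnertonDyer.BirchSwinnertonDyer.Theorems.ManinLocalTwoThree

end
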